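import Mathlib
import HarnessLib
import Summits.ABC.ABC.Theses.CongruentialReceptacle
import Summits.ABC.ABC.Theorems.CongruentialReceptacleTameLocalReceptacleDefs

/-!
# Crux `ReceptacleIdentity` (stmt-ABC-1813), typed face `TameLocalReceptacle` (stmt-ABC-14354):
# the NEAR-MATCHED certificate schema (refutation interface with bounded small-prime defects)

Negative lemma of the crux disprover (`refuter-cdisprove-stmt-ABC-1813-g2-0`, gen 2, 2026-08-17).

The picked decision line `stable-szpiro-duality` (skeleton `Cruxes/ReceptacleIdentity/Lines/stable_szpiro_duality.lean`)
refutes the typed face through EXACTLY residue-matched signed families (`SignedFamily.Matched : ∀ d, 0 ≤ ∂F d`,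
stub `stub_matchedFreeLunch`).  Exact matching is stronger than the mechanism needs: the box inequality
behind Stable Szpiro charges an UNMATCHED negative datum `d = (p; i,j,k; …)` only `c₁' (i+j+k+1) log p`,
which is harmless when `p` and `i+j+k` stay bounded while the gain grows.  This file lands the
correspondingly weaker refutation interface, in the vocabulary of the landed single-table transfer
(`Theorems/CongruentialReceptacleTameLocalReceptacleDefs.lean`: `Table`, `InWindow`, `evalAt`, `recSum`,
`IsBalanced`, `IntegerTameReceptacle`, `itr_of_tlr`):

* a CERTIFICATE is a finite integer-weighted family of `κ`-balanced triples together with two finite lists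
  of prime data with multiplicities, `pos` and `neg`, and the identity, valid for EVERY table `t`,
  `Σ_T w_T · recSum t T = Σ_pos μ · t(d) − Σ_neg μ · t(d)` (the boundary decomposition `∂F = ∂F⁺ − ∂F⁻`,
  stated as an identity so that any bookkeeping proof of it — `decide` on explicit numbers, or a structural
  argument for a parametrised family — can discharge it);
* `certificate_inequality`: a windowed table with `|recSum| ≤ c₃` on the `κ`-cell forces
  `c₁ · gain − c₁' · defect ≤ c₃ · ‖F‖₁`, where `gain = Σ_pos μ (2(i+j+k) − 6 − ε) log p` and
  `defect = Σ_neg μ ((i+j+k) + 1) log p`;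
* `NearMatchedFreeLunch κ ε`: certificates with `defect ≤ K ‖F‖₁` (one `K`) and `gain > C ‖F‖₁` for every `C`;
* `not_integerTameReceptacle_of_nearMatchedFreeLunch`, `TameLocalReceptacle_false_of_nearMatchedFreeLunch`:
  such certificates at ONE `(κ, ε)` refute the single-table receptacle and hence (by `itr_of_tlr`) the crux's
  typed face, for all constants.

Consequences for template hunters (recorded in `Cruxes/ReceptacleIdentity/Disproof.lean` §5): data at the
primes `p ≤ P₀` never need to be matched as long as the NEGATIVE excess there has bounded valuation — in
particular the `2`- and `3`-classes of negatively weighted triples are free, and only the large-prime data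
(`p > P₀`) of negatives must be covered exactly; the exactly matched stub `stub_matchedFreeLunch` of the line
is the special case `neg = []` (`K = 0`).  No statement of the route is asserted positively here.
-/

-- `Summit.<Summit>.<Problem>` is the mandated summit-side namespace (CONVENTIONS §2); for the
-- single-conjunct summit `ABC` the two coincide, so the duplicate `ABC.ABC` is deliberate.
set_option linter.dupNamespace false

namespace Summit.ABC.ABC.Theorems.ReceptacleIdentity.Negative

open Literature.NumberTheory.DiophantineGeometry
open Summit.ABC.ABC.Theses.CongruentialReceptacle
open Summit.ABC.ABC.Theorems.TameLocalReceptacle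

/-! ### Certificate currency

A family entry is `(w, a, b, c)` (integer weight, triple); a datum entry is `(μ, p, (i,j,k,r,s,z))`
(natural multiplicity, prime, the six coordinates of the crux's datum, in the argument order of its table). -/

/-- `‖F‖₁ = Σ |w_T|` of a weighted family, as a real number. -/
def certNorm (fam : List (ℤ × ℕ × ℕ × ℕ)) : ℝ :=
  (((fam.map fun e => |e.1|).sum : ℤ) : ℝ)

/-- The gain of a positive data list: `Σ μ · (2(i+j+k) − 6 − ε) · log p` (the crux's lower window at
`c₁ = 1`). -/
noncomputable def certGain (ε : ℝ) (pos : List (ℕ × ℕ × (ℕ × ℕ × ℕ × ℕ × ℕ × ℕ))) : ℝ :=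
  (pos.map fun e => (e.1 : ℝ) *
    ((2 * ((e.2.2.1 + e.2.2.2.1 + e.2.2.2.2.1 : ℕ) : ℝ) - 6 - ε) * Real.log e.2.1)).sum

/-- The defect of a negative data list: `Σ μ · ((i+j+k) + 1) · log p` (the crux's upper window at
`c₁' = 1`). -/
noncomputable def certDefect (neg : List (ℕ × ℕ × (ℕ × ℕ × ℕ × ℕ × ℕ × ℕ))) : ℝ :=
  (neg.map fun e => (e.1 : ℝ) *
    ((((e.2.2.1 + e.2.2.2.1 + e.2.2.2.2.1 : ℕ) : ℝ) + 1) * Real.log e.2.1)).sum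

/-- The weighted receptacle sum of a family against a table: `Σ_T w_T · recSum t T`. -/
def famSum (t : Table) (fam : List (ℤ × ℕ × ℕ × ℕ)) : ℤ :=
  (fam.map fun e => e.1 * recSum t e.2.1 e.2.2.1 e.2.2.2).sum

/-- The table paired with a data list: `Σ μ · t(p; d)`. -/
def dataSum (t : Table) (l : List (ℕ × ℕ × (ℕ × ℕ × ℕ × ℕ × ℕ × ℕ))) : ℤ :=
  (l.map fun e => (e.1 : ℤ) * evalAt t e.2.1 e.2.2).sum

/-- A NEAR-MATCHED CERTIFICATE at balance `κ` with boundary `(pos, neg)`: a finite integer-weighted family of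
`κ`-balanced abc-triples whose weighted receptacle sum decomposes, for every table, as the table paired with
`pos` minus the table paired with `neg` (all listed primes prime). -/
def IsCertificate (κ : ℝ) (fam : List (ℤ × ℕ × ℕ × ℕ))
    (pos neg : List (ℕ × ℕ × (ℕ × ℕ × ℕ × ℕ × ℕ × ℕ))) : Prop :=
  (∀ e ∈ fam, IsBalanced κ e.2.1 e.2.2.1 e.2.2.2) ∧ (∀ e ∈ pos, e.2.1.Prime) ∧
    (∀ e ∈ neg, e.2.1.Prime) ∧ ∀ t : Table, famSum t fam = dataSum t pos - dataSum t neg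

/-- **NEAR-MATCHED FREE LUNCH at `(κ, ε)`** — the hypothesis of the negative lemma: for one defect ratio `K`
and every `C` there is a certificate with `‖F‖₁ > 0`, `defect ≤ K ‖F‖₁` and `gain > C ‖F‖₁`.  The line's
`MatchedFreeLunch` (exact matching, real weights) implies it with `K = 0` after clearing denominators. -/
def NearMatchedFreeLunch (κ ε : ℝ) : Prop :=
  ∃ K : ℝ, ∀ C : ℝ, ∃ (fam : List (ℤ × ℕ × ℕ × ℕ))
    (pos neg : List (ℕ × ℕ × (ℕ × ℕ × ℕ × ℕ × ℕ × ℕ))),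
    IsCertificate κ fam pos neg ∧ 0 < certNorm fam ∧
      certDefect neg ≤ K * certNorm fam ∧ C * certNorm fam < certGain ε pos

/-! ### The three one-sided estimates (list inductions) -/

/-- `Σ_T w_T recSum t T ≤ c₃ ‖F‖₁` when `|recSum t T| ≤ c₃` on every member of the family. [folklore] -/
theorem famSum_le {κ c₃ : ℝ} {t : Table}
    (hB : ∀ a b c : ℕ, IsBalanced κ a b c → |(recSum t a b c : ℝ)| ≤ c₃) :
    ∀ fam : List (ℤ × ℕ × ℕ × ℕ), (∀ e ∈ fam, IsBalanced κ e.2.1 e.2.2.1 e.2.2.2) →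
      ((famSum t fam : ℤ) : ℝ) ≤ c₃ * certNorm fam := by
  intro fam
  induction fam with
  | nil => intro; simp [famSum, certNorm]
  | cons e l ih =>
    intro h
    have he : IsBalanced κ e.2.1 e.2.2.1 e.2.2.2 := h e (by simp)
    have hl : ∀ e' ∈ l, IsBalanced κ e'.2.1 e'.2.2.1 e'.2.2.2 := fun e' he' => h e' (by simp [he'])
    have ih' := ih hl
    simp only [famSum, certNorm, List.map_cons, List.sum_cons, Int.cast_add, Int.cast_mul,
      Int.cast_abs] at ih' ⊢
    have hr := hB _ _ _ he
    have h1 : ((e.1 : ℤ) : ℝ) * ((recSum t e.2.1 e.2.2.1 e.2.2.2 : ℤ) : ℝ) ≤ |((e.1 : ℤ) : ℝ)| * c₃ :=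
      calc ((e.1 : ℤ) : ℝ) * ((recSum t e.2.1 e.2.2.1 e.2.2.2 : ℤ) : ℝ)
          ≤ |((e.1 : ℤ) : ℝ) * ((recSum t e.2.1 e.2.2.1 e.2.2.2 : ℤ) : ℝ)| := le_abs_self _
        _ = |((e.1 : ℤ) : ℝ)| * |((recSum t e.2.1 e.2.2.1 e.2.2.2 : ℤ) : ℝ)| := abs_mul _ _
        _ ≤ |((e.1 : ℤ) : ℝ)| * c₃ := mul_le_mul_of_nonneg_left hr (abs_nonneg _)
    have h2 : c₃ * (|((e.1 : ℤ) : ℝ)| + (((l.map fun e => |e.1|).sum : ℤ) : ℝ)) =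
        |((e.1 : ℤ) : ℝ)| * c₃ + c₃ * (((l.map fun e => |e.1|).sum : ℤ) : ℝ) := by ring
    rw [h2]
    exact add_le_add h1 ih'

/-- `c₁ · gain ≤ Σ_pos μ t(d)` for a table in the lower window. [folklore] -/
theorem gain_le_dataSum {ε c₁ c₁' : ℝ} {t : Table} (hw : InWindow ε c₁ c₁' t) :
    ∀ pos : List (ℕ × ℕ × (ℕ × ℕ × ℕ × ℕ × ℕ × ℕ)), (∀ e ∈ pos, e.2.1.Prime) →
      c₁ * certGain ε pos ≤ ((dataSum t pos : ℤ) : ℝ) := by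
  intro pos
  induction pos with
  | nil => intro; simp [certGain, dataSum]
  | cons e l ih =>
    intro h
    have he : e.2.1.Prime := h e (by simp)
    have hl : ∀ e' ∈ l, e'.2.1.Prime := fun e' he' => h e' (by simp [he'])
    have ih' := ih hl
    simp only [certGain, dataSum, List.map_cons, List.sum_cons, Int.cast_add, Int.cast_mul,
      Int.cast_natCast] at ih' ⊢
    have hwin := (hw e.2.1 e.2.2.1 e.2.2.2.1 e.2.2.2.2.1 e.2.2.2.2.2.1 e.2.2.2.2.2.2.1
      e.2.2.2.2.2.2.2 he).1
    have hev : ((evalAt t e.2.1 e.2.2 : ℤ) : ℝ) =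
        ((t e.2.1 e.2.2.1 e.2.2.2.1 e.2.2.2.2.1 e.2.2.2.2.2.1 e.2.2.2.2.2.2.1 e.2.2.2.2.2.2.2 : ℤ) : ℝ) :=
      rfl
    have hμ : (0 : ℝ) ≤ (e.1 : ℝ) := Nat.cast_nonneg _
    have h1 : (e.1 : ℝ) * (c₁ * (2 * ((e.2.2.1 + e.2.2.2.1 + e.2.2.2.2.1 : ℕ) : ℝ) - 6 - ε) *
        Real.log e.2.1) ≤ (e.1 : ℝ) * ((evalAt t e.2.1 e.2.2 : ℤ) : ℝ) := by
      rw [hev]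
      exact mul_le_mul_of_nonneg_left hwin hμ
    have h2 : c₁ * ((e.1 : ℝ) * ((2 * ((e.2.2.1 + e.2.2.2.1 + e.2.2.2.2.1 : ℕ) : ℝ) - 6 - ε) *
        Real.log e.2.1) + (l.map fun e => (e.1 : ℝ) *
          ((2 * ((e.2.2.1 + e.2.2.2.1 + e.2.2.2.2.1 : ℕ) : ℝ) - 6 - ε) * Real.log e.2.1)).sum) =
        (e.1 : ℝ) * (c₁ * (2 * ((e.2.2.1 + e.2.2.2.1 + e.2.2.2.2.1 : ℕ) : ℝ) - 6 - ε) *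
          Real.log e.2.1) + c₁ * (l.map fun e => (e.1 : ℝ) *
          ((2 * ((e.2.2.1 + e.2.2.2.1 + e.2.2.2.2.1 : ℕ) : ℝ) - 6 - ε) * Real.log e.2.1)).sum := by
      ring
    rw [h2]
    exact add_le_add h1 ih'

/-- `Σ_neg μ t(d) ≤ c₁' · defect` for a table in the upper window. [folklore] -/
theorem dataSum_le_defect {ε c₁ c₁' : ℝ} {t : Table} (hw : InWindow ε c₁ c₁' t) :
    ∀ neg : List (ℕ × ℕ × (ℕ × ℕ × ℕ × ℕ × ℕ × ℕ)), (∀ e ∈ neg, e.2.1.Prime) →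
      ((dataSum t neg : ℤ) : ℝ) ≤ c₁' * certDefect neg := by
  intro neg
  induction neg with
  | nil => intro; simp [certDefect, dataSum]
  | cons e l ih =>
    intro h
    have he : e.2.1.Prime := h e (by simp)
    have hl : ∀ e' ∈ l, e'.2.1.Prime := fun e' he' => h e' (by simp [he'])
    have ih' := ih hl
    simp only [certDefect, dataSum, List.map_cons, List.sum_cons, Int.cast_add, Int.cast_mul,
      Int.cast_natCast] at ih' ⊢
    have hwin := (hw e.2.1 e.2.2.1 e.2.2.2.1 e.2.2.2.2.1 e.2.2.2.2.2.1 e.2.2.2.2.2.2.1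
      e.2.2.2.2.2.2.2 he).2
    have hev : ((evalAt t e.2.1 e.2.2 : ℤ) : ℝ) =
        ((t e.2.1 e.2.2.1 e.2.2.2.1 e.2.2.2.2.1 e.2.2.2.2.2.1 e.2.2.2.2.2.2.1 e.2.2.2.2.2.2.2 : ℤ) : ℝ) :=
      rfl
    have hμ : (0 : ℝ) ≤ (e.1 : ℝ) := Nat.cast_nonneg _
    have h1 : (e.1 : ℝ) * ((evalAt t e.2.1 e.2.2 : ℤ) : ℝ) ≤ (e.1 : ℝ) *
        (c₁' * (((e.2.2.1 + e.2.2.2.1 + e.2.2.2.2.1 : ℕ) : ℝ) + 1) * Real.log e.2.1) := by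
      rw [hev]
      exact mul_le_mul_of_nonneg_left ((le_abs_self _).trans hwin) hμ
    have h2 : c₁' * ((e.1 : ℝ) * ((((e.2.2.1 + e.2.2.2.1 + e.2.2.2.2.1 : ℕ) : ℝ) + 1) *
        Real.log e.2.1) + (l.map fun e => (e.1 : ℝ) *
          ((((e.2.2.1 + e.2.2.2.1 + e.2.2.2.2.1 : ℕ) : ℝ) + 1) * Real.log e.2.1)).sum) =
        (e.1 : ℝ) * (c₁' * (((e.2.2.1 + e.2.2.2.1 + e.2.2.2.2.1 : ℕ) : ℝ) + 1) * Real.log e.2.1) +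
          c₁' * (l.map fun e => (e.1 : ℝ) *
          ((((e.2.2.1 + e.2.2.2.1 + e.2.2.2.2.1 : ℕ) : ℝ) + 1) * Real.log e.2.1)).sum := by
      ring
    rw [h2]
    exact add_le_add h1 ih'

/-- The defect of a data list with prime entries is nonnegative. [folklore] -/
theorem certDefect_nonneg :
    ∀ neg : List (ℕ × ℕ × (ℕ × ℕ × ℕ × ℕ × ℕ × ℕ)), 0 ≤ certDefect neg := by
  intro neg
  induction neg with
  | nil => simp [certDefect]
  | cons e l ih =>
    simp only [certDefect, List.map_cons, List.sum_cons] at ih ⊢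
    have h1 : 0 ≤ (e.1 : ℝ) * ((((e.2.2.1 + e.2.2.2.1 + e.2.2.2.2.1 : ℕ) : ℝ) + 1) *
        Real.log e.2.1) :=
      mul_nonneg (Nat.cast_nonneg _) (mul_nonneg (by positivity) (Real.log_natCast_nonneg _))
    exact add_nonneg h1 ih

/-! ### The schema -/

/-- **CERTIFICATE INEQUALITY.** A table in the crux's windows whose receptacle sum is bounded by `c₃` on
the `κ`-balanced cell satisfies, on every near-matched certificate at balance `κ`,
`c₁ · gain − c₁' · defect ≤ c₃ · ‖F‖₁`. [folklore] -/
theorem certificate_inequality {κ ε c₁ c₁' c₃ : ℝ} {t : Table} (hw : InWindow ε c₁ c₁' t)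
    (hB : ∀ a b c : ℕ, IsBalanced κ a b c → |(recSum t a b c : ℝ)| ≤ c₃)
    {fam : List (ℤ × ℕ × ℕ × ℕ)} {pos neg : List (ℕ × ℕ × (ℕ × ℕ × ℕ × ℕ × ℕ × ℕ))}
    (hc : IsCertificate κ fam pos neg) :
    c₁ * certGain ε pos - c₁' * certDefect neg ≤ c₃ * certNorm fam := by
  obtain ⟨hfam, hpos, hneg, hid⟩ := hc
  have h1 := famSum_le hB fam hfam
  have h2 := gain_le_dataSum hw pos hpos
  have h3 := dataSum_le_defect hw neg hneg
  have h4 : ((famSum t fam : ℤ) : ℝ) = ((dataSum t pos : ℤ) : ℝ) - ((dataSum t neg : ℤ) : ℝ) := by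
    rw [hid t, Int.cast_sub]
  linarith

/-- **The single-table receptacle is false modulo a near-matched free lunch** at any one `(κ, ε)` with
`κ, ε > 0`. [folklore] -/
theorem not_integerTameReceptacle_of_nearMatchedFreeLunch {κ ε : ℝ} (hκ : 0 < κ) (hε : 0 < ε)
    (h : NearMatchedFreeLunch κ ε) : ¬ IntegerTameReceptacle := by
  intro hI
  obtain ⟨c₁, c₁', c₃, hc₁, t, hw, hB⟩ := hI κ hκ ε hε
  obtain ⟨K, hK⟩ := h
  obtain ⟨fam, pos, neg, hc, hL, hD, hG⟩ := hK ((|c₃| + |c₁'| * K) / c₁ + 1)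
  have hineq := certificate_inequality hw hB hc
  have hD0 := certDefect_nonneg neg
  -- c₁' · defect ≤ |c₁'| · K · ‖F‖₁
  have h1 : c₁' * certDefect neg ≤ |c₁'| * (K * certNorm fam) :=
    (mul_le_mul_of_nonneg_right (le_abs_self c₁') hD0).trans
      (mul_le_mul_of_nonneg_left hD (abs_nonneg _))
  have h2 : c₃ * certNorm fam ≤ |c₃| * certNorm fam :=
    mul_le_mul_of_nonneg_right (le_abs_self c₃) hL.le
  -- so c₁ · gain ≤ (|c₃| + |c₁'| K) ‖F‖₁, contradicting gain > C ‖F‖₁ at the chosen C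
  have h3 : c₁ * (((|c₃| + |c₁'| * K) / c₁ + 1) * certNorm fam) < c₁ * certGain ε pos :=
    mul_lt_mul_of_pos_left hG hc₁
  have h4 : c₁ * (((|c₃| + |c₁'| * K) / c₁ + 1) * certNorm fam) =
      (|c₃| + |c₁'| * K) * certNorm fam + c₁ * certNorm fam := by
    field_simp
  have h5 : 0 < c₁ * certNorm fam := mul_pos hc₁ hL
  nlinarith

/-- **The typed face of the crux is false modulo a near-matched free lunch**: a near-matched free lunch at
ONE `(κ, ε)` with `κ, ε > 0` refutes `Summit.ABC.ABC.Theses.CongruentialReceptacle.TameLocalReceptacle`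
for all constants (through the landed transfer `itr_of_tlr`). [folklore] -/
theorem TameLocalReceptacle_false_of_nearMatchedFreeLunch {κ ε : ℝ} (hκ : 0 < κ) (hε : 0 < ε)
    (h : NearMatchedFreeLunch κ ε) : ¬ TameLocalReceptacle := fun hT =>
  not_integerTameReceptacle_of_nearMatchedFreeLunch hκ hε h (itr_of_tlr hT)

end Summit.ABC.ABC.Theorems.ReceptacleIdentity.Negative
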